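import Summits.BirchSwinnertonDyer.BirchSwinnertonDyer.Theorems.TeichmullerTwistDescentTameGoodModelOfPotentiallyGood
import Summits.BirchSwinnertonDyer.Rank1Residual.Additive.TypeGIntegralJ
import Summits.BirchSwinnertonDyer.Rank1Residual.Additive.AdditiveTorsionFiveSeven
import HarnessLib

/-!
# Route `TeichmullerTwistDescent`: the Néron jump `ord_p Δ_min/12` on the route's CELLS — (G)-ordinary rows
# (PSMU 22638 / GE11 23885), the Kummer corner (5, III) ∪ (7, II) over `ℚ_p(ζ_p) = ℚ_p((−p)^{1/(p−1)})`
# (CORNER 23883, WILD 24306, TAME 24307), and the low-valuation rows `ord_p Δ_min ≤ 3` (LOW 23884's live clause)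
# (`--supports` PSMU, stmt-BirchSwinnertonDyer-22638; route-independent module)

Cell `pub/bsd-wall`, D-0145 line `route-BirchSwinnertonDyer-TeichmullerTwistDescent`, seat `bsd-line-ttd-p1` g15.
BSD is NOT proved by this; Manin's conjecture is not proved by this; no route item is closed. THEOREMS ONLY; imports
no route file. Corollaries of `hasTameGoodModel_of_padicValRat_j_nonneg` (p700114) in the hypothesis currency of the
TTD route decls:

* `hasTameGoodModel_of_typeGOrd` — `TypeGOrd W p` (the PSMU / GE11 / CORNER binder) forces `ord_p j ≥ 0`
  (`padicValRat_j_nonneg_of_typeGOrd`), so `12a = e·ord_p Δ_min ⇒ HasTameGoodModel p e W a` at `p ≥ 5`;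
* `hasTameGoodModel_kummerCorner` — on `(p, ord_p Δ_min) ∈ {(5, 3), (7, 2)}` with `TypeGOrd`:
  `HasTameGoodModel p (p − 1) W 1`, i.e. good reduction over `ℚ(ϖ)`, `ϖ^{p−1} = −p` — locally the cyclotomic field
  `ℚ_p(ζ_p)` of the corner's name — with Néron jump `1/(p − 1)`;
* `hasTameGoodModel_of_addv_of_padicValInt_le_three` — `Addv W p`, `ord_p Δ_min ≤ 3` (Kodaira II/III, potentially
  good whether ordinary or not: `p ∣ c₄` gives `ord_p j ≥ 3 − ord_p Δ ≥ 0`) ⇒ the same conclusion; in particular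
  `hasTameGoodModel_low_five` on LOW's live clause `(5, ord₅ Δ_min = 2)`: `HasTameGoodModel 5 6 W 1` (jump `1/6`).

References: [EdixhovenManin1991] Prop. 4; [SilvermanAEC2009] VII.5 Prop. 5.1, 5.5; [Serre1972] §5.6.
-/

set_option autoImplicit false
-- D-0017: single-problem summit, so `Summit.BirchSwinnertonDyer.BirchSwinnertonDyer.…` repeats a namespace BY DESIGN.
set_option linter.dupNamespace false

noncomputable section

open scoped Classical

open WeierstrassCurve Literature.NumberTheory.EllipticCurves Literature.NumberTheory.EllipticCurves.ModularForms
  Literature.NumberTheory.EllipticCurves.Rank1Residual Summit.BirchSwinnertonDyer.Rank1Residual.Additive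

namespace Summit.BirchSwinnertonDyer.BirchSwinnertonDyer.Theorems.TeichmullerTwistDescent.TameGoodModel

variable (p : ℕ) [hp : Fact p.Prime]

/-- **(G)-ordinary rows** (PSMU / GE11 / CORNER binder `TypeGOrd W p`): `12a = e·ord_p Δ_min ⇒ HasTameGoodModel p e W a`
at `p ≥ 5`, since (G) forces `ord_p j ≥ 0`. [cite: EdixhovenManin1991, Prop. 4] -/
theorem hasTameGoodModel_of_typeGOrd (hp5 : 5 ≤ p) (W : WeierstrassCurve ℚ) [W.IsElliptic] [W.IsGloballyMinimal]
    (hG : TypeGOrd W p) {e a : ℕ} (he : 0 < e) (h12 : 12 * a = e * padicValInt p W.minimalDiscriminantInt) :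
    HasTameGoodModel p e W a :=
  hasTameGoodModel_of_padicValRat_j_nonneg p hp5 W (padicValRat_j_nonneg_of_typeGOrd W p hG) he h12

/-- **The Kummer corner `(5, III) ∪ (7, II)`** (CORNER stmt-23883, WILD 24306, TAME 24307: `e = p − 1`): good
reduction over `ℚ(ϖ)`, `ϖ^{p−1} = −p` (locally `ℚ_p(ζ_p)`), with Néron exponent `1`: `HasTameGoodModel p (p − 1) W 1`.
[cite: EdixhovenManin1991, Prop. 4] [cite: SerreLocalFields1979, IV §4 (ℚ_p(ζ_p) = ℚ_p((−p)^{1/(p−1)}))] -/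
theorem hasTameGoodModel_kummerCorner (W : WeierstrassCurve ℚ) [W.IsElliptic] [W.IsGloballyMinimal]
    (hcell : (p = 5 ∧ padicValInt p W.minimalDiscriminantInt = 3) ∨ (p = 7 ∧ padicValInt p W.minimalDiscriminantInt = 2))
    (hG : TypeGOrd W p) : HasTameGoodModel p (p - 1) W 1 := by
  rcases hcell with ⟨rfl, h3⟩ | ⟨rfl, h2⟩
  · exact hasTameGoodModel_of_typeGOrd 5 le_rfl W hG (by norm_num) (by rw [h3])
  · exact hasTameGoodModel_of_typeGOrd 7 (by norm_num) W hG (by norm_num) (by rw [h2])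

/-- **Low-valuation additive rows `ord_p Δ_min ≤ 3` at `p ≥ 5`** (Kodaira II / III, ordinary or not): `p ∣ c₄`
(`padicValRat_c₄_c₆_of_addv`) gives `ord_p j = 3·ord_p c₄ − ord_p Δ ≥ 0`, hence
`12a = e·ord_p Δ_min ⇒ HasTameGoodModel p e W a`. [cite: SilvermanAEC2009, VII.5 Prop. 5.1] -/
theorem hasTameGoodModel_of_addv_of_padicValInt_le_three (hp5 : 5 ≤ p) (W : WeierstrassCurve ℚ) [W.IsElliptic]
    [W.IsGloballyMinimal] (hadd : Rank1Residual.Addv W p) (hd : padicValInt p W.minimalDiscriminantInt ≤ 3) {e a : ℕ}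
    (he : 0 < e) (h12 : 12 * a = e * padicValInt p W.minimalDiscriminantInt) : HasTameGoodModel p e W a := by
  refine hasTameGoodModel_of_padicValRat_j_nonneg p hp5 W ?_ he h12
  have hΔ0 : W.Δ ≠ 0 := W.Δ'.ne_zero
  have vΔ : padicValRat p W.Δ = padicValInt p W.minimalDiscriminantInt := by
    rw [← cast_minimalDiscriminantInt W, padicValRat.of_int]
  rcases (padicValRat_c₄_c₆_of_addv W p hadd).1 with h0 | h1
  · rw [W.j_eq_zero h0]; simp
  · have hc0 : W.c₄ ≠ 0 := by
      rintro h; rw [h] at h1; simp at h1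
    rw [WeierstrassCurve.j, Units.val_inv_eq_inv_val, coe_Δ', padicValRat.mul (inv_ne_zero hΔ0) (pow_ne_zero 3 hc0),
      padicValRat.inv, padicValRat.pow, vΔ]
    have : (padicValInt p W.minimalDiscriminantInt : ℤ) ≤ 3 := by exact_mod_cast hd
    push_cast
    linarith

/-- **LOW's live clause `(5, ord₅ Δ_min = 2)`** (stmt-23884; Kodaira II at `5`, potentially supersingular): good
reduction over `ℚ(ϖ)`, `ϖ⁶ = −5`, with Néron exponent `1` — `HasTameGoodModel 5 6 W 1` (jump `1/6`).
[cite: EdixhovenManin1991, Prop. 4] -/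
theorem hasTameGoodModel_low_five (W : WeierstrassCurve ℚ) [W.IsElliptic] [W.IsGloballyMinimal]
    (hadd : Rank1Residual.Addv W 5) (h2 : padicValInt 5 W.minimalDiscriminantInt = 2) : HasTameGoodModel 5 6 W 1 :=
  haveI : Fact (Nat.Prime 5) := ⟨by norm_num⟩
  hasTameGoodModel_of_addv_of_padicValInt_le_three 5 le_rfl W hadd (by rw [h2]; norm_num) (by norm_num) (by rw [h2])

end Summit.BirchSwinnertonDyer.BirchSwinnertonDyer.Theorems.TeichmullerTwistDescent.TameGoodModel

end
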